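import Mathlib
import Literature.Barriers.ValiantsHypothesis.AlgebraicNaturalProofs
import Literature.Computability.AlgebraicComplexity.KRSTSelection
import HarnessLib

/-!
# Item `BarrierLever.NaturalProofsSeparateVNP` (stmt-ValiantsHypothesis-18972), SIGN SLICE —
# part 0: integer coefficient vectors on `degLEMonomials n` and integer evaluation

Support file for the unconditional SIGN-SLICE form of the item (CKRST 2020, Thm. 1.1, tree frame).
Bookkeeping only: a polynomial of degree `≤ n` with coefficients in `{0, 1, -1}` (a member of the
tree's `signCoeffSlice ℂ n` inside FSV's space `H(degLEMonomials n)`) is the same thing as an integer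
vector `c : degLEMonomials n → ℤ` with entries in `{0, 1, -1}`, and its value at a point `a ∈ ℕ^n` is
the integer `∑_m c_m a^m`.

* `SignSlice.ofIntVec c` — the polynomial `∑_m c_m x^m`; `coeff_ofIntVec`, `coeffVector_ofIntVec`,
  `totalDegree_ofIntVec_le`, `ofIntVec_eq_zero_iff`, `ofIntVec_mem_signCoeffSlice`;
* `SignSlice.monoVal a m = ∏ i, a_i^{m_i}`, `SignSlice.intEval a c = ∑_m c_m · monoVal a m`,
  `eval_natCast_ofIntVec` (`(ofIntVec c)(a) = intEval a c` in `ℂ`), `monoVal_le_pow`;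
* `SignSlice.sgnVec f` — the integer vector of a member of the sign slice; `ofIntVec_sgnVec`
  (`f = ofIntVec (sgnVec f)` when `deg f ≤ n`).

References: [ChatterjeeKumarRamyaSaptharishiTengse2020] §4 (the map `f ↦ ⟨coeff(f), eval(a)⟩`);
[ForbesShpilkaVolk2018] Def. 1 (coefficient vectors).
-/

-- layout Summits/ValiantsHypothesis/ValiantsHypothesis forces the duplicated namespace component
set_option linter.dupNamespace false

noncomputable section

namespace Summit.ValiantsHypothesis.ValiantsHypothesis.Theorems.BarrierLever.NaturalProofsSeparateVNP

open Literature.Barriers.ValiantsHypothesis Literature.Computability.AlgebraicComplexity MvPolynomial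

namespace SignSlice

variable {n : ℕ}

/-! ### Integer coefficient vectors as polynomials -/

/-- The polynomial `∑_{m ∈ degLEMonomials n} c_m x^m ∈ ℂ[x_1, …, x_n]` with integer coefficient
vector `c`. [cite: ForbesShpilkaVolk2018, Def. 1] -/
def ofIntVec (c : degLEMonomials n → ℤ) : MvPolynomial (Fin n) ℂ :=
  ∑ m : degLEMonomials n, monomial (m : Fin n →₀ ℕ) (c m : ℂ)

/-- Coefficients of `ofIntVec c` on the coordinate monomials. [cite: ForbesShpilkaVolk2018, Def. 1] -/
theorem coeff_ofIntVec (c : degLEMonomials n → ℤ) (m : degLEMonomials n) :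
    coeff (m : Fin n →₀ ℕ) (ofIntVec c) = c m := by
  classical
  unfold ofIntVec
  rw [coeff_sum, Finset.sum_eq_single m]
  · rw [coeff_monomial, if_pos rfl]
  · intro m' _ hm'
    rw [coeff_monomial, if_neg]
    exact fun h => hm' (Subtype.ext h)
  · intro h; exact absurd (Finset.mem_univ m) h

/-- Coefficients of `ofIntVec c` off the coordinate monomials vanish. [cite: ForbesShpilkaVolk2018, Def. 1] -/
theorem coeff_ofIntVec_of_not (c : degLEMonomials n → ℤ) {μ : Fin n →₀ ℕ}
    (hμ : μ ∉ degLEMonomials n) : coeff μ (ofIntVec c) = 0 := by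
  classical
  unfold ofIntVec
  rw [coeff_sum]
  refine Finset.sum_eq_zero fun m _ => ?_
  rw [coeff_monomial, if_neg]
  intro h; exact hμ (h ▸ m.2)

/-- The coefficient vector of `ofIntVec c` is `c` (cast to `ℂ`). [cite: ForbesShpilkaVolk2018, Def. 1] -/
theorem coeffVector_ofIntVec (c : degLEMonomials n → ℤ) :
    coeffVector (degLEMonomials n) (ofIntVec c) = fun m => (c m : ℂ) := by
  funext m; rw [coeffVector_apply, coeff_ofIntVec]

/-- `ofIntVec c` has total degree `≤ n`. [cite: ForbesShpilkaVolk2018, Def. 1] -/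
theorem totalDegree_ofIntVec_le (c : degLEMonomials n → ℤ) : (ofIntVec c).totalDegree ≤ n := by
  classical
  unfold ofIntVec
  refine totalDegree_finsetSum_le fun m _ => (totalDegree_monomial_le _ _).trans ?_
  have := m.2
  simp only [degLEMonomials, Set.mem_setOf_eq, Finsupp.degree_apply] at this
  exact this

/-- `ofIntVec` is injective: `ofIntVec c = 0 ↔ c = 0`. [cite: ForbesShpilkaVolk2018, Def. 1] -/
theorem ofIntVec_eq_zero_iff (c : degLEMonomials n → ℤ) : ofIntVec c = 0 ↔ c = 0 := by
  constructor
  · intro h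
    funext m
    have := coeff_ofIntVec c m
    rw [h, coeff_zero] at this
    exact_mod_cast this.symm
  · rintro rfl
    simp [ofIntVec]

/-- A vector with entries in `{0, 1, -1}` gives a member of the sign slice.
[cite: ChatterjeeKumarRamyaSaptharishiTengse2020, Thm. 1.1] -/
theorem ofIntVec_mem_signCoeffSlice {c : degLEMonomials n → ℤ}
    (hc : ∀ m, c m = 0 ∨ c m = 1 ∨ c m = -1) : ofIntVec c ∈ signCoeffSlice ℂ n := by
  classical
  intro μ
  by_cases hμ : μ ∈ degLEMonomials n
  · have := coeff_ofIntVec c ⟨μ, hμ⟩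
    simp only at this
    rw [this]
    rcases hc ⟨μ, hμ⟩ with h | h | h <;> simp [h]
  · exact Or.inl (coeff_ofIntVec_of_not c hμ)

/-! ### Integer evaluation at a point of `ℕ^n` -/

/-- The value `a^m = ∏ i, a_i^{m_i}` of a monomial at `a ∈ ℕ^n`. [folklore] -/
def monoVal (a : Fin n → ℕ) (m : Fin n →₀ ℕ) : ℕ := ∏ i, a i ^ m i

/-- `a^m ≤ B^n` when every `a_i ≤ B` (`B ≥ 1`) and `deg m ≤ n`. [folklore] -/
theorem monoVal_le_pow {a : Fin n → ℕ} {B : ℕ} (hB : 1 ≤ B) (ha : ∀ i, a i ≤ B)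
    (m : degLEMonomials n) : monoVal a m ≤ B ^ n := by
  unfold monoVal
  calc ∏ i, a i ^ (m : Fin n →₀ ℕ) i ≤ ∏ i, B ^ (m : Fin n →₀ ℕ) i :=
        Finset.prod_le_prod' fun i _ => Nat.pow_le_pow_left (ha i) _
    _ = B ^ (∑ i, (m : Fin n →₀ ℕ) i) := (Finset.prod_pow_eq_pow_sum _ _ _)
    _ ≤ B ^ n := by
        refine Nat.pow_le_pow_right hB ?_
        have h2 := m.2
        simp only [degLEMonomials, Set.mem_setOf_eq] at h2
        rwa [Finsupp.degree_eq_sum] at h2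

/-- The integer `∑_m c_m a^m`. [cite: ChatterjeeKumarRamyaSaptharishiTengse2020, §4] -/
def intEval (a : Fin n → ℕ) (c : degLEMonomials n → ℤ) : ℤ :=
  ∑ m : degLEMonomials n, c m * (monoVal a m : ℤ)

/-- `intEval` is additive in the coefficient vector. [folklore] -/
theorem intEval_sub (a : Fin n → ℕ) (c c' : degLEMonomials n → ℤ) :
    intEval a (c - c') = intEval a c - intEval a c' := by
  simp only [intEval, Pi.sub_apply, sub_mul, Finset.sum_sub_distrib]

/-- Size bound: `|∑_m c_m a^m| ≤ N · B^n` for entries `|c_m| ≤ 1`, `a ∈ [0, B]^n`.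
[cite: ChatterjeeKumarRamyaSaptharishiTengse2020, §4] -/
theorem natAbs_intEval_le {a : Fin n → ℕ} {B : ℕ} (hB : 1 ≤ B) (ha : ∀ i, a i ≤ B)
    {c : degLEMonomials n → ℤ} (hc : ∀ m, (c m).natAbs ≤ 1) :
    (intEval a c).natAbs ≤ Fintype.card (degLEMonomials n) * B ^ n := by
  unfold intEval
  calc (∑ m, c m * (monoVal a m : ℤ)).natAbs
      ≤ ∑ m, (c m * (monoVal a m : ℤ)).natAbs := Int.natAbs_sum_le _ _
    _ ≤ ∑ _m : degLEMonomials n, B ^ n := Finset.sum_le_sum fun m _ => by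
        rw [Int.natAbs_mul, Int.natAbs_natCast]
        calc (c m).natAbs * monoVal a m ≤ 1 * B ^ n :=
              Nat.mul_le_mul (hc m) (monoVal_le_pow hB ha m)
          _ = B ^ n := one_mul _
    _ = Fintype.card (degLEMonomials n) * B ^ n := by
        rw [Finset.sum_const, smul_eq_mul, Finset.card_univ]

/-- Evaluating `ofIntVec c` at the point `a ∈ ℕ^n` (inside `ℂ`) gives the integer `intEval a c`.
[cite: ChatterjeeKumarRamyaSaptharishiTengse2020, §4] -/
theorem eval_natCast_ofIntVec (a : Fin n → ℕ) (c : degLEMonomials n → ℤ) :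
    eval (fun i => (a i : ℂ)) (ofIntVec c) = (intEval a c : ℂ) := by
  unfold ofIntVec intEval monoVal
  rw [map_sum]
  push_cast
  refine Finset.sum_congr rfl fun m _ => ?_
  rw [eval_monomial]
  simp [Finsupp.prod_fintype]

/-! ### From a member of the sign slice to its integer vector -/

/-- The integer coefficient vector of a polynomial with coefficients in `{0, 1, -1}`.
[cite: ChatterjeeKumarRamyaSaptharishiTengse2020, Thm. 1.1] -/
def sgnVec (f : MvPolynomial (Fin n) ℂ) : degLEMonomials n → ℤ := fun m =>
  if coeff (m : Fin n →₀ ℕ) f = 1 then 1 else if coeff (m : Fin n →₀ ℕ) f = -1 then -1 else 0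

/-- Entries of `sgnVec f` lie in `{0, 1, -1}`. [cite: ChatterjeeKumarRamyaSaptharishiTengse2020, Thm. 1.1] -/
theorem sgnVec_mem (f : MvPolynomial (Fin n) ℂ) (m : degLEMonomials n) :
    sgnVec f m = 0 ∨ sgnVec f m = 1 ∨ sgnVec f m = -1 := by
  unfold sgnVec; split_ifs <;> simp

/-- Entries of `sgnVec f` have absolute value `≤ 1`. [cite: ChatterjeeKumarRamyaSaptharishiTengse2020, Thm. 1.1] -/
theorem natAbs_sgnVec_le (f : MvPolynomial (Fin n) ℂ) (m : degLEMonomials n) :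
    (sgnVec f m).natAbs ≤ 1 := by
  rcases sgnVec_mem f m with h | h | h <;> simp [h]

/-- On the sign slice, `sgnVec f` casts back to the coefficients of `f`.
[cite: ChatterjeeKumarRamyaSaptharishiTengse2020, Thm. 1.1] -/
theorem cast_sgnVec {f : MvPolynomial (Fin n) ℂ} (hf : f ∈ signCoeffSlice ℂ n)
    (m : degLEMonomials n) : ((sgnVec f m : ℤ) : ℂ) = coeff (m : Fin n →₀ ℕ) f := by
  unfold sgnVec
  rcases hf (m : Fin n →₀ ℕ) with h | h | h
  · rw [h]; simp
  · rw [h]; simp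
  · rw [h]
    have : (-1 : ℂ) ≠ 1 := by norm_num
    simp [this]

/-- A member of the sign slice of degree `≤ n` IS `ofIntVec` of its integer vector.
[cite: ChatterjeeKumarRamyaSaptharishiTengse2020, Thm. 1.1] -/
theorem ofIntVec_sgnVec {f : MvPolynomial (Fin n) ℂ} (hf : f ∈ signCoeffSlice ℂ n)
    (hdeg : f.totalDegree ≤ n) : ofIntVec (sgnVec f) = f := by
  classical
  refine MvPolynomial.ext _ _ fun μ => ?_
  by_cases hμ : μ ∈ degLEMonomials n
  · have := coeff_ofIntVec (sgnVec f) ⟨μ, hμ⟩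
    simp only at this
    rw [this, cast_sgnVec hf]
  · rw [coeff_ofIntVec_of_not _ hμ]
    symm
    refine coeff_eq_zero_of_totalDegree_lt (lt_of_le_of_lt hdeg ?_)
    simp only [degLEMonomials, Set.mem_setOf_eq, not_le, Finsupp.degree_apply] at hμ
    exact hμ

/-- Hence on the sign slice: `f(a) = intEval a (sgnVec f)` in `ℂ`, for `a ∈ ℕ^n`.
[cite: ChatterjeeKumarRamyaSaptharishiTengse2020, §4] -/
theorem eval_natCast_eq_intEval {f : MvPolynomial (Fin n) ℂ} (hf : f ∈ signCoeffSlice ℂ n)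
    (hdeg : f.totalDegree ≤ n) (a : Fin n → ℕ) :
    eval (fun i => (a i : ℂ)) f = (intEval a (sgnVec f) : ℂ) := by
  conv_lhs => rw [← ofIntVec_sgnVec hf hdeg]
  exact eval_natCast_ofIntVec a _

/-- And the coefficient vector of `f` is the cast of `sgnVec f`. [cite: ForbesShpilkaVolk2018, Def. 1] -/
theorem coeffVector_eq_cast_sgnVec {f : MvPolynomial (Fin n) ℂ} (hf : f ∈ signCoeffSlice ℂ n) :
    coeffVector (degLEMonomials n) f = fun m => ((sgnVec f m : ℤ) : ℂ) := by
  funext m; rw [coeffVector_apply, cast_sgnVec hf]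

/-- `0` lies in the sign slice. [folklore] -/
theorem zero_mem_signCoeffSlice : (0 : MvPolynomial (Fin n) ℂ) ∈ signCoeffSlice ℂ n :=
  fun _ => Or.inl (coeff_zero _)

end SignSlice

end Summit.ValiantsHypothesis.ValiantsHypothesis.Theorems.BarrierLever.NaturalProofsSeparateVNP
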